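/-
Copyright (c) 2026 the pub-hodgecm-mathlib formalisation cell (harness21).  Prover seat hodgecm-mathlib-LH4-p11 (g9), req620 Track A «(D-RAM) FOUR-FRAME» squad, helper lane on
h413 = stmt-HodgeConjecture-24833 (count-neutral).  β-BOARD v1 ROW R6 «SPECIAL κ-CLASSES» — second LATTICE INPUT in G₃ currency for LH4-p08 (g10)'s head: the κ-locus strata lie
ENTIRELY on the clean shell (LH4-cdis1 (g0) KAPPA-CLASS-CONTENT 868191d7, as a theorem).  Proof pattern adapted from LH7-p06 (g0)'s ★ p861341 `shell_iff_of_mem_stratum_G3`.  2026-09-04.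
-/
import Summits.HodgeConjecture.HodgeConjecture.Theorems.F0P3cDyRamLabelledOddPureStrataG3Shell   -- ★ p861341∕p861424 (LH7-p06 (g0)): `latticeInLevel_diagonal_latt_G3_iff{_of_ne}`; brings ★ p861251 `stratum_G3_eq`, ★ DEFS №5
import HarnessLib

/-!
# Crux `H413`, line LH4 «(D-RAM) FOUR-FRAME» — (β-BAL) Stage B, β-BOARD ROW R6 «SPECIAL κ-CLASSES», LATTICE INPUT 2 (tower 3): ON THE κ-LOCUS `2ρ + ℓ₀ = n₂`, BELOW THE READ,
# EVERY MEMBER OF THE STRATUM `G₃(ρ, s) = (2ρ+s, 2ρ+s, 2ρ)` IS ON THE CLEAN SHELL — the shell cut is the whole stratum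

Cell `hodgecm-mathlib` (D-0151), FLOOR 0, crux item H413 = `stmt-HodgeConjecture-24833`, route `HCCMUnconditional`; squad F0∕P3c∕LH4.  THEOREMS ONLY (no `def`, no instance, no
notation, no `sorry`, default heartbeats); ★-only imports; lane `--supports stmt-HodgeConjecture-24833 --as helper` (count-neutral); pays NO row, states NO law.
WHAT.  For the operator of record `X = diag(α−1, β−1, 0)` the level tokens on the G₃ normal form `latt (1 0 0; x ϖ^{ρ+s} 0; y z ϖ^{2ρ})` are constant reads off the cancellation locus
`n₃ = n₂ + s` (★ `latticeInLevel_diagonal_latt_G3_iff_of_ne`): `X·M ⊆ ϖ^ℓ M ↔ ℓ ≤ min(n₁ − ρ, n₂ − 2ρ, n₃ − 2ρ − s)` (and `ℓ ≤ n₁, n₂`).  On the κ-LOCUS `2ρ + ℓ₀ = n₂` and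
BELOW THE READ `2ρ + s + ℓ₀ < n₃` (the κ-classes of the special tower 3: `n₁ = n₂ = m`, `2 ≤ s ≤ s_g − 2`; there `n₃ ≠ n₂ + s` automatically and the isosceles rule forces `n₂ ≤ n₁`)
the minimum is `ℓ₀` EXACTLY, attained in the `|e₂ − e₀| = |α − 1|` letter: so `X·M ⊆ ϖ^{ℓ₀}M`, `X·M ⊄ ϖ^{ℓ₀+1}M`, and the square token `X²·M ⊆ ϖ^{mc}M` holds from `mc ≤ N₀ ≤ n₂`
(`2n₂ ≥ mc + 2ρ ⟺ n₂ + ℓ₀ ≥ mc`; the mixed letter by the ultrametric maximum and `|(α−1)² − (β−1)²| ≤ |ϖ|^{n₃ + min n₁ n₂}`).  Heads: **`shell_of_mem_stratum_G3_kappaLocus`** (the three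
tokens on every member), **`sep_shell_eq_stratum_G3_kappaLocus`** (the clean-shell cut `{M ∈ stratum | shell}` IS the stratum — so the table's `Σᶠ` over the cut is the `Σᶠ` over the
stratum, and ★ p861570 `twoSlotLabel_latt_G3_foot`'s `hlev ∕ hnlev ∕ hsq` are discharged on the whole κ-class), `le_of_kappaLocus_G3` (`n₂ ≤ n₁`, `n₃ ≠ n₂ + s` there).
HONEST LABEL.  Count-neutral (`--supports`); nothing printed is asserted; R6 (LH4-p08 (g10)), hRest, (β-BAL), (β) `stub_law_cleanSgn`, T₊ remain OPEN; `HC_CM` is proved only modulo the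
7 printed citations (2 remaining named inputs: hLiu418 = `stmt-HodgeConjecture-24832`, h413 = `stmt-HodgeConjecture-24833`) until rung 0 closes.
References: [Kottwitz1986BaseChangeUnits] §1 pp. 240–241 · [Rogawski1990] §4.9 Prop. 4.9.1 (a)(b) p. 55 · [Serre1980Trees] Ch. II §1.1.
-/

set_option autoImplicit false

noncomputable section

namespace Summit.HodgeConjecture.HodgeConjecture.Cruxes.H413.F0P3cDyRamLabelledOddKappaClassShellG3

open Literature.NumberTheory.Automorphic Literature.NumberTheory.Automorphic.HermitianLattice
open Literature.NumberTheory.Automorphic.UnitaryLatticeTree Literature.NumberTheory.Automorphic.UnitaryThreeFourFrame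
open Summit.HodgeConjecture.HodgeConjecture.Cruxes.H413.F0P3cDyRamFourFramePieces
open Summit.HodgeConjecture.HodgeConjecture.Cruxes.H413.F0P3cDyRamFourFrameCensusDefs
open Summit.HodgeConjecture.HodgeConjecture.Cruxes.H413.F0P3cDyRamStageOneBDefs (mcOfRecord)
open Summit.HodgeConjecture.HodgeConjecture.Cruxes.H413.F0P3cDyRamDiagonalTorusDefs
open Summit.HodgeConjecture.HodgeConjecture.Cruxes.H413.F0P3cDyRamDiagonalStrataDefs
open Summit.HodgeConjecture.HodgeConjecture.Cruxes.H413.F0P3cDyRamDiagonalGluedStratumG3 (stratum_G3_eq)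
open Summit.HodgeConjecture.HodgeConjecture.Cruxes.H413.F0P3cDyRamLabelledOddPureStrataG3Shell (latticeInLevel_diagonal_latt_G3_iff latticeInLevel_diagonal_latt_G3_iff_of_ne)
open scoped Valued WithZero Matrix MatrixGroups

variable {K : Type} [Field K] [Valued K ℤᵐ⁰] {σ : K →+* K} {ϖ : K} {d t : ℕ} {α β : K} {N₀ n₁ n₂ n₃ : ℕ}

/-- **THE DEPTHS AT THE κ-LOCUS BELOW THE READ** (token-free, lattice-free): if `2ρ + ℓ₀ = n₂` and `2ρ + s + ℓ₀ < n₃` (`s ≥ 1`) then `n₂ ≤ n₁` (isosceles: `n₁ < n₂` would force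
`n₃ = n₁ < n₂`) and the stratum is off the cancellation locus, `n₃ ≠ n₂ + s`. [cite: Kottwitz1986BaseChangeUnits, §1 pp. 240–241] -/
theorem le_of_kappaLocus_G3 (hD : IsRamifiedQuadraticDatum σ ϖ d t) (hE : IsElementDatum σ ϖ N₀ α β n₁ n₂ n₃)
    (ρ s : ℕ) (hκ : 2 * ρ + d % 2 = n₂) (hlt : 2 * ρ + s + d % 2 < n₃) : n₂ ≤ n₁ ∧ n₃ ≠ n₂ + s := by
  have hD' := hD
  obtain ⟨-, -, hϖ, -, -, -, -⟩ := hD'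
  have hα : Valued.v (α - 1) = Valued.v ϖ ^ n₂ := hE.2.2.2.2.2.2.1
  have hβ : Valued.v (β - 1) = Valued.v ϖ ^ n₁ := hE.2.2.2.2.2.1
  have hγ : Valued.v (α - β) = Valued.v ϖ ^ n₃ := hE.2.2.2.2.2.2.2.1
  have hq : ∀ n : ℕ, Valued.v ϖ ^ n = WithZero.exp (-(n : ℤ)) := fun n => by
    rw [hϖ, ← WithZero.exp_nsmul]; congr 1; simp
  have hpwlt : ∀ a b : ℕ, Valued.v ϖ ^ a < Valued.v ϖ ^ b ↔ b < a := fun a b => by rw [hq, hq, WithZero.exp_lt_exp]; omega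
  have hpweq : ∀ a b : ℕ, Valued.v ϖ ^ a = Valued.v ϖ ^ b ↔ a = b := fun a b => by rw [hq, hq, WithZero.exp_inj]; omega
  have hγ' : Valued.v (β - 1 - (α - 1)) = Valued.v ϖ ^ n₃ := by rw [show β - 1 - (α - 1) = -(α - β) by ring, Valuation.map_neg, hγ]
  have hiso₁ : n₁ < n₂ → n₃ = n₁ := fun h => by
    have hlt' : Valued.v (α - 1) < Valued.v (β - 1) := by rw [hα, hβ, hpwlt]; exact h
    have e := Valuation.map_sub_eq_of_lt_left _ hlt'
    rw [hγ', hβ, hpweq] at e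
    exact e
  refine ⟨?_, by omega⟩
  by_contra h
  have := hiso₁ (by omega)
  omega

/-- **ON THE κ-LOCUS BELOW THE READ, EVERY MEMBER OF `G₃(ρ, s)` IS ON THE CLEAN SHELL**: for `2ρ + ℓ₀ = n₂`, `2ρ + s + ℓ₀ < n₃`, `ρ, s ≥ 1`, `mcOfRecord d ≤ N₀`, and every
`M ∈ stratum σ ϖ T (2ρ+s, 2ρ+s, 2ρ)`: `X·M ⊆ ϖ^{ℓ₀}M`, `X·M ⊄ ϖ^{ℓ₀+1}M`, `X²·M ⊆ ϖ^{mcOfRecord d}M` for `X = diag(α−1, β−1, 0)` — the X-level is `min(n₁ − ρ, n₂ − 2ρ, n₃ − 2ρ − s) = ℓ₀`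
(★ constant reads off the locus), the square token by `n₂ + ℓ₀ ≥ mcOfRecord d`.  LH4-cdis1's «every κ-class stratum lies entirely on the clean shell at level ℓ₀», for tower 3.
[cite: Kottwitz1986BaseChangeUnits, §1 pp. 240–241] [cite: Rogawski1990, §4.9 Prop. 4.9.1 (a) p. 55] [cite: Serre1980Trees, Ch. II §1.1] -/
theorem shell_of_mem_stratum_G3_kappaLocus (hD : IsRamifiedQuadraticDatum σ ϖ d t)
    (hE : IsElementDatum σ ϖ N₀ α β n₁ n₂ n₃) (hmc : mcOfRecord d ≤ N₀)
    (T : GL (Fin 3) K) (ρ s : ℕ) (hρ : 1 ≤ ρ) (hs : 1 ≤ s) (hκ : 2 * ρ + d % 2 = n₂) (hlt : 2 * ρ + s + d % 2 < n₃) :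
    ∀ M ∈ stratum σ ϖ T ![2 * ρ + s, 2 * ρ + s, 2 * ρ],
      LatticeInLevel ϖ (d % 2) (Matrix.diagonal ![α - 1, β - 1, 0]) M ∧ ¬ LatticeInLevel ϖ (d % 2 + 1) (Matrix.diagonal ![α - 1, β - 1, 0]) M ∧
        LatticeInLevel ϖ (mcOfRecord d) (Matrix.diagonal ![(α - 1) * (α - 1), (β - 1) * (β - 1), 0]) M := by
  classical
  have hD' := hD
  obtain ⟨hσ, hvσ, hϖ, hfix, -, hd1, -⟩ := hD'
  have hϖ0 : ϖ ≠ 0 := fun h0 => by rw [h0, map_zero] at hϖ; exact WithZero.coe_ne_zero hϖ.symm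
  have hα : Valued.v (α - 1) = Valued.v ϖ ^ n₂ := hE.2.2.2.2.2.2.1
  have hβ : Valued.v (β - 1) = Valued.v ϖ ^ n₁ := hE.2.2.2.2.2.1
  have hγ : Valued.v (α - β) = Valued.v ϖ ^ n₃ := hE.2.2.2.2.2.2.2.1
  have hn₁ : N₀ ≤ n₁ := hE.2.2.2.2.2.2.2.2.1
  have hn₂ : N₀ ≤ n₂ := hE.2.2.2.2.2.2.2.2.2.1
  have hn₃ : N₀ ≤ n₃ := hE.2.2.2.2.2.2.2.2.2.2
  obtain ⟨h21, hfoot⟩ := le_of_kappaLocus_G3 hD hE ρ s hκ hlt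
  have hmcv : mcOfRecord d = 2 * ((d % 2 + 2 * d - 1 + d) / 2) := rfl
  rw [hmcv] at hmc ⊢
  have hq : ∀ n : ℕ, Valued.v ϖ ^ n = WithZero.exp (-(n : ℤ)) := fun n => by
    rw [hϖ, ← WithZero.exp_nsmul]; congr 1; simp
  have hpw : ∀ a b : ℕ, Valued.v ϖ ^ a ≤ Valued.v ϖ ^ b ↔ b ≤ a := fun a b => by rw [hq, hq, WithZero.exp_le_exp]; omega
  have hpweq : ∀ a b : ℕ, Valued.v ϖ ^ a = Valued.v ϖ ^ b ↔ a = b := fun a b => by rw [hq, hq, WithZero.exp_inj]; omega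
  have hv0 : ∀ k : ℕ, Valued.v (0 : K) ≤ Valued.v ϖ ^ k := fun k => by rw [map_zero]; exact zero_le
  have hγ' : Valued.v (β - 1 - (α - 1)) = Valued.v ϖ ^ n₃ := by rw [show β - 1 - (α - 1) = -(α - β) by ring, Valuation.map_neg, hγ]
  have hγ'' : Valued.v (α - 1 - (β - 1)) = Valued.v ϖ ^ n₃ := by rw [show α - 1 - (β - 1) = α - β by ring, hγ]
  have hA2 : Valued.v ((α - 1) * (α - 1)) = Valued.v ϖ ^ (2 * n₂) := by rw [map_mul, hα, ← pow_add, two_mul]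
  have hB2 : Valued.v ((β - 1) * (β - 1)) = Valued.v ϖ ^ (2 * n₁) := by rw [map_mul, hβ, ← pow_add, two_mul]
  have hsqdiff : Valued.v ((α - 1) * (α - 1) - (β - 1) * (β - 1)) ≤ Valued.v ϖ ^ (n₃ + n₂) := by
    rw [show (α - 1) * (α - 1) - (β - 1) * (β - 1) = (α - β) * ((α - 1) + (β - 1)) by ring, map_mul, hγ, pow_add]
    refine mul_le_mul' le_rfl ((Valuation.map_add _ _ _).trans (max_le ?_ ?_))
    · rw [hα]
    · rw [hβ, hpw]; exact h21
  intro M hM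
  rw [stratum_G3_eq hvσ hfix hϖ T hρ hs] at hM
  obtain ⟨x, y, z, hx, hy, hz, rfl, -, -⟩ := hM
  -- off the cancellation locus the level tokens are constant reads
  have hne : Valued.v ((![α - 1, β - 1, 0] : Fin 3 → K) 2 - (![α - 1, β - 1, 0] : Fin 3 → K) 0) * Valued.v ϖ ^ s ≠
      Valued.v ((![α - 1, β - 1, 0] : Fin 3 → K) 0 - (![α - 1, β - 1, 0] : Fin 3 → K) 1) := by
    simp only [Matrix.cons_val_zero, Matrix.cons_val_one, Matrix.cons_val_two, Matrix.tail_cons, Matrix.head_cons, zero_sub, Valuation.map_neg, hα, hγ'', ← pow_add]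
    rw [Ne, hpweq]; omega
  have htok : ∀ ℓ : ℕ, LatticeInLevel ϖ ℓ (Matrix.diagonal ![α - 1, β - 1, 0])
      (latt (!![1, 0, 0; x, ϖ ^ (ρ + s), 0; y, z, ϖ ^ (2 * ρ)] : Matrix (Fin 3) (Fin 3) K)) ↔
        (ℓ ≤ n₂ ∧ ℓ ≤ n₁) ∧ ℓ + ρ + s ≤ n₃ ∧ ℓ + ρ ≤ n₁ ∧ (ℓ + 2 * ρ ≤ n₂ ∧ ℓ + 2 * ρ + s ≤ n₃) := fun ℓ => by
    rw [latticeInLevel_diagonal_latt_G3_iff_of_ne hϖ0 ℓ ρ s _ hx hy hz hne]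
    simp only [Matrix.cons_val_zero, Matrix.cons_val_one, Matrix.cons_val_two, Matrix.tail_cons, Matrix.head_cons, zero_sub, Valuation.map_neg, hv0, and_true,
      hα, hβ, hγ', hγ'', hpw]
  refine ⟨(htok _).2 ⟨⟨by omega, by omega⟩, by omega, by omega, by omega, by omega⟩, fun h => ?_, ?_⟩
  · obtain ⟨-, -, -, h2, -⟩ := (htok _).1 h
    omega
  · -- THE SQUARE TOKEN: `2n₂ ≥ mc + 2ρ` (i.e. `n₂ + ℓ₀ ≥ mc`), `n₃ + n₂ ≥ mc + 2ρ + s`, `2n₁ ≥ mc + ρ`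
    rw [latticeInLevel_diagonal_latt_G3_iff hϖ0 _ ρ s _ hx y hz]
    simp only [Matrix.cons_val_zero, Matrix.cons_val_one, Matrix.cons_val_two, Matrix.tail_cons, Matrix.head_cons, zero_sub, Valuation.map_neg]
    refine ⟨⟨?_, ?_, hv0 _⟩, ?_, ?_, ?_⟩
    · rw [hA2, hpw]; omega
    · rw [hB2, hpw]; omega
    · rw [show (β - 1) * (β - 1) - (α - 1) * (α - 1) = -((α - 1) * (α - 1) - (β - 1) * (β - 1)) by ring, Valuation.map_neg]
      refine hsqdiff.trans ?_
      rw [hpw]; omega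
    · rw [hB2, hpw]; omega
    · refine (Valuation.map_add _ _ _).trans (max_le ?_ ?_)
      · rw [map_mul, map_mul, Valuation.map_neg, hA2, hy, mul_one, map_pow, ← pow_add, hpw]; omega
      · rw [map_mul, map_mul, hx, mul_one, hz, map_pow]
        refine (mul_le_mul' hsqdiff le_rfl).trans ?_
        rw [← pow_add, hpw]; omega

/-- **THE CLEAN-SHELL CUT IS THE WHOLE STRATUM ON THE κ-LOCUS BELOW THE READ**: `{M | M ∈ stratum G₃(ρ,s) ∧ shell M} = stratum G₃(ρ,s)` — so the (β) table's `Σᶠ` over the cut is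
the `Σᶠ` over the stratum there, and the per-lattice heads' shell hypotheses are discharged uniformly. [cite: Kottwitz1986BaseChangeUnits, §1 pp. 240–241] -/
theorem sep_shell_eq_stratum_G3_kappaLocus (hD : IsRamifiedQuadraticDatum σ ϖ d t)
    (hE : IsElementDatum σ ϖ N₀ α β n₁ n₂ n₃) (hmc : mcOfRecord d ≤ N₀)
    (T : GL (Fin 3) K) (ρ s : ℕ) (hρ : 1 ≤ ρ) (hs : 1 ≤ s) (hκ : 2 * ρ + d % 2 = n₂) (hlt : 2 * ρ + s + d % 2 < n₃) :
    {M : Submodule 𝒪[K] (Fin 3 → K) | M ∈ stratum σ ϖ T ![2 * ρ + s, 2 * ρ + s, 2 * ρ] ∧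
        (LatticeInLevel ϖ (d % 2) (Matrix.diagonal ![α - 1, β - 1, 0]) M ∧ ¬ LatticeInLevel ϖ (d % 2 + 1) (Matrix.diagonal ![α - 1, β - 1, 0]) M ∧
          LatticeInLevel ϖ (mcOfRecord d) (Matrix.diagonal ![(α - 1) * (α - 1), (β - 1) * (β - 1), 0]) M)} =
      stratum σ ϖ T ![2 * ρ + s, 2 * ρ + s, 2 * ρ] := by
  ext M
  exact ⟨fun h => h.1, fun h => ⟨h, shell_of_mem_stratum_G3_kappaLocus hD hE hmc T ρ s hρ hs hκ hlt M h⟩⟩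

end Summit.HodgeConjecture.HodgeConjecture.Cruxes.H413.F0P3cDyRamLabelledOddKappaClassShellG3

end
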